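import Literature.NumberTheory.EllipticCurves.SupersingularDensitySerreProofs
import Literature.NumberTheory.EllipticCurves.OrdinaryPrimesProofs
import Literature.NumberTheory.EllipticCurves.BSDGoldfeldEulerProduct
import HarnessLib

/-!
# Density `0` of the supersingular primes (Serre) — proofs, part 2: `p ∣ a_p` versus `a_p = 0`,
# and the finitely many bad primes

Second `…Proofs` file (theorems only, nothing is defined) of the series working towards the named
fact `WeierstrassCurve.serre_supersingular_density_zero` of
`Literature.NumberTheory.EllipticCurves.SupersingularDensity` (Serre 1981, §8, Thm. 20 / Cor. 2);
part 1 is `Literature.NumberTheory.EllipticCurves.SupersingularDensitySerreProofs` (density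
calculus, the `GL₂(𝔽_q)` count).

Serre counts `P_{E,0}(x) = #{p ≤ x : p ∉ S_E, a_p = 0}` (1981, (240), p. 188) and remarks (p. 123)
that for `p ≠ 2` the condition `a_p = 0` is supersingularity of the reduction; the tree's set
`WeierstrassCurve.goodSupersingularPrimes W` is `{p good : p ∣ a_p}`.  This file identifies the two
away from `{2, 3}` and records that the excluded primes are finitely many:

* `WeierstrassCurve.frobeniusTrace_sq_le_four_mul` — **Hasse's bound `a_p² ≤ 4p` at a prime of
  good reduction** for the tree's `frobeniusTrace` (computed on the global minimal model), read
  off the place-indexed version `Literature.NumberTheory.EllipticCurves.BSDGoldfeld.sq_le_four_mul_of_hasGoodReductionAt`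
  (`BSDGoldfeldEulerProduct`; Silverman, *AEC*, Thm. V.1.1 with VII.1.3(b)) through
  `hasGoodReductionAtPrime_primesEquiv_iff_holds` (`LFunctionPrimeCoeff`);
* `WeierstrassCurve.natCast_dvd_frobeniusTrace_iff_eq_zero` — for `p ≥ 5` of good reduction,
  `p ∣ a_p ↔ a_p = 0`; hence `WeierstrassCurve.mem_goodSupersingularPrimes_iff_of_five_le`:
  for `p ≥ 5`, `p ∈ goodSupersingularPrimes W ↔ p` is a good prime with `a_p = 0` (Serre's set);
* `WeierstrassCurve.finite_setOf_prime_not_hasGoodReductionAtPrime` — the primes of bad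
  reduction divide the minimal discriminant (`hasGoodReductionAtPrime_of_not_dvd`,
  `OrdinaryPrimesProofs`), so they are finitely many (Serre's finite set `S_E`, p. 188);
* `WeierstrassCurve.hasPrimeDensity_goodSupersingularPrimes_iff` — consequently the density of
  `goodSupersingularPrimes W` is that of Serre's set `{p good : a_p = 0}` (finitely many
  exceptions do not matter, part 1).

## References

* [Serre1981] J.-P. Serre, *Quelques applications du théorème de densité de Chebotarev*, Publ.
  Math. IHÉS 54 (1981): p. 123; §8.1–8.2, (240), Thm. 20, Cor. 2 (pp. 188–189).
* [SilvermanAEC2009] J. H. Silverman, *The Arithmetic of Elliptic Curves*, 2nd ed. (2009):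
  Thm. V.1.1 (Hasse), Prop. VII.1.3(b), VII.5 Prop. 5.1(a).
-/

noncomputable section

open scoped Classical
open IsDedekindDomain NumberField Rat.HeightOneSpectrum

namespace WeierstrassCurve

variable (W : WeierstrassCurve ℚ) [W.IsElliptic] [W.IsGloballyMinimal]

/-- **Hasse's bound at a prime of good reduction**, for the trace of Frobenius of the global
minimal model: `a_p² ≤ 4p` (Silverman, *AEC*, Thm. V.1.1, `|a_p| ≤ 2√p`; the reductions of the
global and of the local minimal model have the same number of points, VII.1.3(b)).  Transport of
`BSDGoldfeld.sq_le_four_mul_of_hasGoodReductionAt` from the place `v` over `p` to the prime `p`.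
[cite: SilvermanAEC2009, Thm. V.1.1] -/
theorem frobeniusTrace_sq_le_four_mul (p : ℕ) [hp : Fact p.Prime]
    (hgood : W.HasGoodReductionAtPrime p) : W.frobeniusTrace p ^ 2 ≤ 4 * p := by
  set v : HeightOneSpectrum (𝓞 ℚ) := primesEquiv.symm ⟨p, hp.out⟩ with hv
  have hvp : (primesEquiv v : ℕ) = p := by rw [hv, Equiv.apply_symm_apply]
  have hgood' : W.HasGoodReductionAt v :=
    (hasGoodReductionAtPrime_primesEquiv_iff_holds W v p hvp).mp hgood
  have h := Literature.NumberTheory.EllipticCurves.BSDGoldfeld.sq_le_four_mul_of_hasGoodReductionAt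
    W v hgood'
  rw [hvp] at h
  exact h

/-- `|a_p| ≤ 2√p` at a prime of good reduction (real form of `frobeniusTrace_sq_le_four_mul`).
[cite: SilvermanAEC2009, Thm. V.1.1] -/
theorem abs_frobeniusTrace_le (p : ℕ) [Fact p.Prime] (hgood : W.HasGoodReductionAtPrime p) :
    |(W.frobeniusTrace p : ℝ)| ≤ 2 * Real.sqrt p := by
  have h : ((W.frobeniusTrace p : ℝ)) ^ 2 ≤ 4 * p := by
    exact_mod_cast W.frobeniusTrace_sq_le_four_mul p hgood
  rw [← Real.sqrt_sq_eq_abs, show (2 : ℝ) * Real.sqrt p = Real.sqrt (4 * p) by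
    rw [Real.sqrt_mul (by norm_num), show Real.sqrt 4 = 2 by
      rw [show (4 : ℝ) = 2 ^ 2 by norm_num, Real.sqrt_sq (by norm_num)]]]
  exact Real.sqrt_le_sqrt h

/-- **For `p ≥ 5` of good reduction, `p ∣ a_p ↔ a_p = 0`** (Hasse: `a_p² ≤ 4p < p²` unless
`a_p = 0`; Serre 1981, p. 123: away from `p = 2`, `a_p = 0` is supersingularity).
[cite: Serre1981, §8.1–8.2 (pp. 188–189) with p. 123] -/
theorem natCast_dvd_frobeniusTrace_iff_eq_zero (p : ℕ) [Fact p.Prime] (hp5 : 5 ≤ p)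
    (hgood : W.HasGoodReductionAtPrime p) :
    (p : ℤ) ∣ W.frobeniusTrace p ↔ W.frobeniusTrace p = 0 :=
  Literature.NumberTheory.EllipticCurves.natCast_dvd_iff_eq_zero_of_sq_le hp5
    (W.frobeniusTrace_sq_le_four_mul p hgood)

/-- **Serre's set.** For `p ≥ 5`: `p ∈ goodSupersingularPrimes W` iff `p` is a prime of good
reduction with `a_p = 0` — the primes counted by Serre's `P_{E,0}` (1981, (240), p. 188).
[cite: Serre1981, §8.2 (240)] -/
theorem mem_goodSupersingularPrimes_iff_of_five_le {p : ℕ} (hp5 : 5 ≤ p) :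
    p ∈ W.goodSupersingularPrimes ↔
      ∃ _ : Fact p.Prime, W.HasGoodReductionAtPrime p ∧ W.frobeniusTrace p = 0 := by
  constructor
  · rintro ⟨hp, hgood, hdvd⟩
    exact ⟨hp, hgood, (W.natCast_dvd_frobeniusTrace_iff_eq_zero p hp5 hgood).mp hdvd⟩
  · rintro ⟨hp, hgood, h0⟩
    exact ⟨hp, hgood, h0 ▸ dvd_zero _⟩

/-- For `p ≥ 5` in `goodSupersingularPrimes W` the trace of Frobenius vanishes. [folklore] -/
theorem frobeniusTrace_eq_zero_of_mem_goodSupersingularPrimes {p : ℕ} (hp5 : 5 ≤ p)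
    (h : p ∈ W.goodSupersingularPrimes) : W.frobeniusTrace p = 0 := by
  obtain ⟨_, -, h0⟩ := (W.mem_goodSupersingularPrimes_iff_of_five_le hp5).mp h
  exact h0

omit [W.IsElliptic] in
/-- A prime of bad reduction divides the minimal discriminant (contrapositive of
`hasGoodReductionAtPrime_of_not_dvd`, `OrdinaryPrimesProofs`; Silverman, *AEC*, VII.5.1(a)).
[folklore] -/
theorem natCast_dvd_minimalDiscriminantInt_of_not_hasGoodReductionAtPrime (p : ℕ) [Fact p.Prime]
    (h : ¬ W.HasGoodReductionAtPrime p) : (p : ℤ) ∣ minimalDiscriminantInt W := by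
  by_contra hnd
  exact h (hasGoodReductionAtPrime_of_not_dvd W p hnd)

/-- **The primes of bad reduction are finitely many** (Serre's finite set `S_E`, 1981, p. 188;
they divide the non-zero minimal discriminant). [folklore] -/
theorem finite_setOf_prime_not_hasGoodReductionAtPrime :
    {p : ℕ | ∃ _ : Fact p.Prime, ¬ W.HasGoodReductionAtPrime p}.Finite := by
  refine (minimalDiscriminantInt W).natAbs.primeFactors.finite_toSet.subset fun p hp => ?_
  obtain ⟨hp, hbad⟩ := hp
  have hdvd := W.natCast_dvd_minimalDiscriminantInt_of_not_hasGoodReductionAtPrime p hbad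
  simp only [Finset.mem_coe, Nat.mem_primeFactors, ne_eq, Int.natAbs_eq_zero]
  exact ⟨hp.out, Int.natCast_dvd.mp hdvd, minimalDiscriminantInt_ne_zero W⟩

/-- Outside `{2, 3}` the tree's `goodSupersingularPrimes W` and Serre's set
`{p : p good, a_p = 0}` have the same primes. [folklore] -/
theorem mem_goodSupersingularPrimes_iff_of_ne {p : ℕ} (hp : p.Prime) (h2 : p ≠ 2) (h3 : p ≠ 3) :
    p ∈ W.goodSupersingularPrimes ↔
      p ∈ {p : ℕ | ∃ _ : Fact p.Prime, W.HasGoodReductionAtPrime p ∧ W.frobeniusTrace p = 0} := by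
  have hp5 : 5 ≤ p := by
    by_contra h
    push Not at h
    have h2le := hp.two_le
    interval_cases p
    · exact h2 rfl
    · exact h3 rfl
    · exact absurd hp (by norm_num)
  exact W.mem_goodSupersingularPrimes_iff_of_five_le hp5

/-- **The density of `goodSupersingularPrimes W` is the density of Serre's set**
`{p good : a_p = 0}`: the two sets differ at most in the primes `2, 3` (part 1,
`HasPrimeDensity.congr` and `HasPrimeDensity.of_finite_diff`). [folklore] -/
theorem hasPrimeDensity_goodSupersingularPrimes_iff (δ : ℝ) :
    HasPrimeDensity W.goodSupersingularPrimes δ ↔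
      HasPrimeDensity {p : ℕ | ∃ _ : Fact p.Prime, W.HasGoodReductionAtPrime p ∧
        W.frobeniusTrace p = 0} δ := by
  set T : Set ℕ := {p : ℕ | ∃ _ : Fact p.Prime, W.HasGoodReductionAtPrime p ∧
    W.frobeniusTrace p = 0} with hT
  have hfin : ∀ S S' : Set ℕ, (∀ p, p.Prime → p ≠ 2 → p ≠ 3 → (p ∈ S ↔ p ∈ S')) →
      (∀ p ∈ S, p.Prime) → (S \ S').Finite := fun S S' h hS =>
    (Set.finite_insert.2 (Set.finite_singleton 3) : ({2, 3} : Set ℕ).Finite).subset fun p hp => by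
      obtain ⟨hpS, hpS'⟩ := hp
      by_contra hne
      simp only [Set.mem_insert_iff, Set.mem_singleton_iff, not_or] at hne
      exact hpS' ((h p (hS p hpS) hne.1 hne.2).mp hpS)
  have hST : ∀ p, p.Prime → p ≠ 2 → p ≠ 3 → (p ∈ W.goodSupersingularPrimes ↔ p ∈ T) :=
    fun p hp h2 h3 => W.mem_goodSupersingularPrimes_iff_of_ne hp h2 h3
  have hTS : ∀ p, p.Prime → p ≠ 2 → p ≠ 3 → (p ∈ T ↔ p ∈ W.goodSupersingularPrimes) :=
    fun p hp h2 h3 => (hST p hp h2 h3).symm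
  have hSprime : ∀ p ∈ W.goodSupersingularPrimes, p.Prime := fun p hp =>
    prime_of_mem_goodSupersingularPrimes hp
  have hTprime : ∀ p ∈ T, p.Prime := fun p ⟨hp, _⟩ => hp.out
  constructor
  · intro h
    exact h.of_finite_diff (hfin _ _ hTS hTprime) (hfin _ _ hST hSprime)
  · intro h
    exact h.of_finite_diff (hfin _ _ hST hSprime) (hfin _ _ hTS hTprime)

end WeierstrassCurve
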